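import Mathlib
import HarnessLib

/-!
# S2 frame objects: the conductor-𝟙 core ring `Aₙ = k[u₁,…,uₙ][Dₙ⁻¹]`
(crux stmt-ResolutionOfSingularities-15640 `WildQuotients.WildQuotientResolution`, line `Sketch`;
chain w45c, post-V5 programme S2 «diagonal products / conductor-𝟙 core» (`L/w45c/CHAIN.md` v9 §4–§5,
lead-1 successor row S2-P2); design `L/res-L1-w45c-lead-1/S2-DESIGN.md` (lead-1 g5) after card L of
res-L1-w45c-idea-2 (`Ideas/conductor-one-kummer-core`, Sketch L10a/L10b). [OURS · L1 W4.5c] —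
replaces the role of no printed item; NOT a statement of the manuscript. Lead prover res-L1-w45c-lead-1.)

The conductor-𝟙 core is the diagonal `ℤ/p`-quotient of the product of `n` germs of the curve action
`z ↦ z + 1` at `z = ∞` (`u = 1/z`, `σ u = u/(1+u)`), in its affine model: the polynomial ring
`k[u₁,…,uₙ]` with the `σ`-stable denominator `Dₙ = ∏ᵢ (1 − uᵢ^{p−1}) = ∏ᵢ ∏_{j ∈ 𝔽_p} (1 + j·uᵢ)`
inverted, so that every iterate `σʲ(uᵢ) = uᵢ/(1 + j·uᵢ)` is defined. This DEFINITIONS file fixes the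
three symbols against which the S2 bricks are typed (verbatim the objects L10a/L10b of idea-2's typed
card L, moved to the tree so that Theorems files can import them):

* `ConductorOne.coreDenominator k p n = ∏ᵢ (1 − X i ^ (p − 1))`;
* `ConductorOne.CoreRing k p n = Localization.Away (coreDenominator k p n)` (an `abbrev`, so that the
  `CommRing`/`Algebra` structure of the localisation is found by unfolding);
* `ConductorOne.coreU k p n i` — the image of the coordinate `uᵢ` in `CoreRing k p n`.

No theorems live here (definition lane); the unit facts, the existence/uniqueness/order of the
automorphism `σ` with `σ(uᵢ)·(1+uᵢ) = uᵢ` and the invariants `Tᵢ = uᵢ^p/(1 − uᵢ^{p−1})` are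
`…ConductorOneAction.lean`.
-/

-- single-problem summit: the doubled namespace component `ResolutionOfSingularities` is forced
set_option linter.dupNamespace false

noncomputable section

open MvPolynomial

namespace Summit.ResolutionOfSingularities.ResolutionOfSingularities.Theorems.WildQuotientResolution.ConductorOne

/-- The `σ`-stable denominator of the affine model of the conductor-𝟙 core:
`Dₙ := ∏ᵢ (1 − uᵢ^{p−1})` (`= ∏ᵢ ∏_{j ∈ 𝔽_p} (1 + j·uᵢ)` in characteristic `p`), so that every
`1 + j·uᵢ` becomes a unit and `σʲ(uᵢ) = uᵢ/(1 + j·uᵢ)` is defined on `k[u][Dₙ⁻¹]`.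
[OURS · L1 W4.5c] -/
def coreDenominator (k : Type) [Field k] (p n : ℕ) : MvPolynomial (Fin n) k :=
  ∏ i : Fin n, (1 - X i ^ (p - 1))

/-- The coordinate ring `Aₙ := k[u₁,…,uₙ][Dₙ⁻¹]` of the `σ`-stable affine neighbourhood of the
fixed point `u = 0` — equivalently of `(∞,…,∞) ∈ (ℙ¹)ⁿ` under the diagonal translation
`zᵢ ↦ zᵢ + 1`, `uᵢ = 1/zᵢ`. [OURS · L1 W4.5c] -/
abbrev CoreRing (k : Type) [Field k] (p n : ℕ) : Type :=
  Localization.Away (coreDenominator k p n)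

/-- The coordinate `uᵢ` as an element of `Aₙ = CoreRing k p n`. [OURS · L1 W4.5c] -/
abbrev coreU (k : Type) [Field k] (p n : ℕ) (i : Fin n) : CoreRing k p n :=
  algebraMap (MvPolynomial (Fin n) k) (CoreRing k p n) (X i)

end Summit.ResolutionOfSingularities.ResolutionOfSingularities.Theorems.WildQuotientResolution.ConductorOne

end
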